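import Literature.Analysis.FluidPDE.FourierL2Convolution
import HarnessLib

/-!
# Fourier-side transport structure of the Euler/Navier–Stokes nonlinearity: the energy
# cancellation and the `H^m` commutator estimate (Majda–Bertozzi 2002, §3.2, on the Fourier side)

First file of the Fourier–Galerkin construction of local smooth solutions of the Euler and
Navier–Stokes equations on `ℝ³` for `H^∞` data with lifespan controlled by the `H³` norm
(discharge of `Literature.Analysis.FluidPDE.MajdaBertozzi2002_localExistenceH3`,
`NSVorticityBKM.lean`; A. J. Majda, A. L. Bertozzi, *Vorticity and Incompressible Flow*, CUP 2002,
§3.2, Thm. 3.4). Majda–Bertozzi regularise the equations by mollifiers `J_ε` in the symmetric form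
`vₜ + P J_ε[(J_ε v)·∇(J_ε v)] = ν J_ε² Δv` ((3.50), p. 100), whose point is that the regularised
nonlinearity keeps the transport structure: `{P J_ε[(J_ε v)·∇ w], w'}` vanishes when `w' = J_ε w`
("the specific choice of regularization … provides a balance of terms for the integration by
parts", p. 103; the proof of (3.53) on pp. 102–103 and of Prop. 3.7 on p. 105:
`{P J_ε[(J_ε v)·∇(D^α J_ε v)], D^α v} = ½ (J_ε v, ∇|J_ε D^α v|²) = -½ (div J_ε v, |J_ε D^α v|²) = 0`).
The tree runs this construction on the **Fourier side** (velocity `u = Re 𝓕 v`, products ↔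
frequency convolutions `FourierNS.fconv`, the projected nonlinearity `FourierNS.nonlin`), where a
sharp frequency truncation replaces `J_ε` and the solution is synthesised by the accepted
`FourierNS.IsSobolevMild.isClassicalNSSolutionOn` (valid for `ν ≥ 0`). This file provides the
Fourier-side form of the integration-by-parts identities:

* `conj_transportForm_ae`, `conj_integral_transportForm`, `im_integral_transportForm_eq_zero` —
  the **transport form** `S = ∫∫ ∑_{j,k} η_j v_j(ξ − η) G_k(η) conj G_k(ξ) dη dξ` of a transporting
  field `v` that is divergence free (`∑_j ζ_j v_j(ζ) = 0`) and conjugation symmetric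
  (`v(-ζ) = conj v(ζ)`, reality of `Re 𝓕 v`) almost everywhere is **real**: `conj F(ξ, η) = F(η, ξ)`
  a.e. and Fubini. This is `∫ (u·∇)w · w = 0`;
* `sum_lerayDerivSymbol_mul_conj`, `sum_nonlin_mul_conj_eq` — pairing with a divergence-free field
  removes the Leray projector, `∑_l N(v, W)_l conj G_l = -2πi ∑_{j,k} ξ_j (v_j ⋆ W_k) conj G_k`;
* `sum_coord_mul_fconv_eq_integral` — incompressibility moves the derivative onto the transported
  factor, `∑_j ξ_j (v_j ⋆ W_k)(ξ) = ∫ ∑_j η_j v_j(ξ − η) W_k(η) dη`;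
* `integral_sum_nonlin_mul_conj_eq`, `re_integral_sum_nonlin_mul_conj_eq_zero` — hence
  `∫ ∑_l N(v, W)_l conj G_l = -2πi ∫∫ ∑ η_j v_j(ξ − η) W_k(η) conj G_k(ξ)` and, for `W = G`
  divergence free, **`Re ∫ ∑_l N(v, G)(ξ)_l conj G_l(ξ) dξ = 0`** (the `L²` energy cancellation,
  used at every truncation level and for differences of truncations, MB Lemma 3.7, term `R5`);
* `enorm_nonlin_le_of_divFree` — `‖N(v, W)(ξ)_l‖ ≤ 4π ∑_{j,k} ((‖·‖|W_k|) ⋆ₗ |v_j|)(ξ)`: with a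
  divergence-free transporting field no derivative falls on `v` (the bound behind MB's `R2`–`R4`);
* the elementary ingredients: the **weight commutator inequality**
  `|(1 + ‖ξ‖)^m − (1 + ‖η‖)^m| ≤ m 2^(m-1) (‖ξ − η‖ (1 + ‖η‖)^(m-1) + (1 + ‖ξ − η‖)^m)`
  (`abs_weight_sub_weight_le`, the Fourier-side Leibniz rule behind the calculus inequality (3.32)
  of Lemma 3.4, p. 98), the trilinear Young bounds `∫ Θ (Φ ⋆ₗ Ψ) ≤ ‖Θ‖₂ ‖Φ‖₂ ‖Ψ‖₁`
  (`lintegral_mul_lconv_le`, `lintegral_mul_lconv_le'`) and the integrability of the transport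
  kernel on `E × E` (`integrable_transportKernel`, `integrable_transportForm`).

On these rests the **`H^m` energy (commutator) estimate** (Majda–Bertozzi Prop. 3.7, (3.58),
p. 105: `½ d/dt ‖v^ε‖²_m + ν‖J_ε∇v^ε‖²_m ≤ c_m |∇J_εv^ε|_{L^∞} ‖v^ε‖²_m`, from the cancellation of the
top-order term and the calculus inequality (3.32)); with the weights `ρ_m = (1 + ‖·‖)^m` of the
Sobolev norm (3.29) and the `L¹_ξ` moment `‖‖·‖v̂‖_{L¹}` in place of `|∇u|_∞` (which it dominates):

* `lintegral_lintegral_commutatorKernel_le` — the commutator kernel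
  `Q(ξ, η) = ∑_{j,k} η_j v_j(ξ − η)(ρ(ξ) − ρ(η)) G_k(η) ρ(ξ) conj G_k(ξ)` has
  `∫∫ ‖Q‖ ≤ m2^(m-1) ∑_k ‖ρG_k‖₂ (‖‖·‖ρ_(m-1)G_k‖₂ ‖‖·‖V‖₁ + ‖ρV‖₂ ‖‖·‖G_k‖₁)`, `V = ∑_j |v_j|`;
* `ofReal_abs_re_integral_weight_sq_nonlin_le` — for `v` divergence free and conjugation symmetric
  a.e. and `G` divergence free a.e., `|Re ∫ ∑_l ρ(ξ)² N(v, G)(ξ)_l conj G_l(ξ) dξ| ≤ 2π · (the bound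
  above)`; with `G = v` this is `|½ d/dt ∑_k ‖ρ_m v̂_k‖²₂| ≲_m ‖‖·‖v̂‖_{L¹} ∑_k ‖ρ_m v̂_k‖²₂`, the
  Fourier form of (3.58) at `ν = 0` (the viscous term only helps and is left to the user);
* weighted square-integrability bookkeeping (`memLp_of_weight_succ`, …).

Everything is stated for coefficient fields `E → ι → ℂ`, `E = EuclideanSpace ℝ ι`, with
componentwise `L¹`/`L²`/weighted-`L²` hypotheses (`MeasureTheory.MemLp`, `Integrable`) and a.e.
divergence-free / conjugation-symmetry hypotheses, the form in which truncated `L²` fields satisfy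
them. No definitions are introduced.

## Mathlib / tree search

Tree (`lean search fconv|lconv|nonlin|lerayDerivSymbol`): `FourierNS.fconv`, `nonlin`,
`lerayDerivSymbol`, `sum_mul_lerayDerivSymbol`, `abs_leray_entry_le_two` (`NSFourierWeights`,
`NSFourierBilinear`); `lconv_apply`, `lintegral_lconv_sq_le` (Young, squared form),
`lconv_le_sqrt_mul_sqrt`, `memLp_comp_sub_left`, `integrable_fconv_integrand`, `aesm_apply`
(`FourierL2Convolution`). No Fourier-side energy identity for the Navier–Stokes/Euler nonlinearity
exists in the tree (`lean search 'cancellation|transport.*fconv|nonlin.*conj'`: only the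
physical-space `hasCancellation_eulerBilinear` of `TaoAveragedEuler`, a different object).
No commutator / Kato–Ponce type estimate exists on the Fourier side either (`lean search
'commutator|KatoPonce|calculus inequality'`: physical-space Moser-type inequalities only,
`Ferrari1993MoserInequality`, `ConvectCommutatorCalculus`, on cylinders / with cutoffs).
Mathlib: `MeasureTheory.integral_integral_swap`, `integral_sub_left_eq_self`,
`Measure.measurePreserving_sub_left`, `quasiMeasurePreserving_sub`, `Measure.ae_ae_of_ae_prod`,
`integral_conj`, `abs_pow_sub_pow_le`, `lconvolution_comm`, `ENNReal.lintegral_mul_le_Lp_mul_Lq`,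
`Integrable.prod_right_ae`, `Integrable.integral_prod_left`, `lintegral_prod`,
`Complex.abs_im_le_norm`.

## References

* A. J. Majda, A. L. Bertozzi, *Vorticity and Incompressible Flow*, Cambridge Texts in Applied
  Mathematics, CUP 2002: §3.2.1 Lemma 3.4 (3.31)–(3.32) (pp. 97–98), (3.48)–(3.52) (pp. 100–101),
  (3.29) (p. 97), Prop. 3.6 with (3.53) and its proof (pp. 101–103), Prop. 3.7 (3.58) and its
  proof (p. 105), (3.59)–(3.60) (p. 106), Lemma 3.7 (3.61) and its proof (pp. 107–108). Page numbers are those of the held text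
  (`book:majda2002-vorticity-incompressible-flow`, chunk = page − 12). [MajdaBertozzi2002]
-/

noncomputable section

open MeasureTheory Real Set Filter Function
open scoped ENNReal NNReal Convolution ComplexConjugate
open _root_.Topology

namespace Literature.Analysis.FluidPDE.FourierNS

variable {ι : Type*} [Fintype ι]

/-! ### The polynomial weights `ρ_m = (1 + ‖·‖)^m`: commutator inequality -/

section Weights

variable {E : Type*} [NormedAddCommGroup E]

/-- `max s d ^ k ≤ s ^ k + d ^ k` for `s, d ≥ 0`. [folklore] -/
theorem max_pow_le_add_pow {s d : ℝ} (hs : 0 ≤ s) (hd : 0 ≤ d) (k : ℕ) :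
    max s d ^ k ≤ s ^ k + d ^ k := by
  rcases le_total s d with h | h
  · rw [max_eq_right h]; linarith [pow_nonneg hs k]
  · rw [max_eq_left h]; linarith [pow_nonneg hd k]

/-- **Weight commutator inequality.** For `m ≥ 1` and all `ξ, η`,
`|(1 + ‖ξ‖)^m − (1 + ‖η‖)^m| ≤ m 2^(m-1) (‖ξ − η‖ (1 + ‖η‖)^(m-1) + (1 + ‖ξ − η‖)^m)`:
the Fourier-side form of the Leibniz/commutator structure `D^m(uv) − u D^m v` (one derivative
falls on `u`, at most `m − 1` on `v`, or all `m` on `u`), cf. the calculus inequality (3.32) of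
Majda–Bertozzi 2002. Proof: `|t^m − s^m| ≤ |t − s| m max(t,s)^(m-1)` with `t = 1 + ‖ξ‖`,
`s = 1 + ‖η‖`, `|t − s| ≤ ‖ξ − η‖`, `max(t, s) ≤ s + ‖ξ − η‖ ≤ 2 max(s, ‖ξ − η‖)`. [cite: MajdaBertozzi2002, Lemma 3.4 (3.32)] -/
theorem abs_weight_sub_weight_le (m : ℕ) (ξ η : E) :
    |(1 + ‖ξ‖) ^ m - (1 + ‖η‖) ^ m| ≤
      m * 2 ^ (m - 1) * (‖ξ - η‖ * (1 + ‖η‖) ^ (m - 1) + (1 + ‖ξ - η‖) ^ m) := by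
  rcases Nat.eq_zero_or_pos m with rfl | hm
  · simp
  set t : ℝ := 1 + ‖ξ‖ with ht
  set s : ℝ := 1 + ‖η‖ with hs
  set d : ℝ := ‖ξ - η‖ with hd
  have ht0 : 0 ≤ t := by positivity
  have hs0 : 0 ≤ s := by positivity
  have hd0 : 0 ≤ d := norm_nonneg _
  have hts : |t - s| ≤ d := by
    rw [ht, hs, hd, add_sub_add_left_eq_sub]
    exact abs_norm_sub_norm_le ξ η
  have htsd : t ≤ s + d := by
    rw [ht, hs, hd]
    have : ‖ξ‖ ≤ ‖η‖ + ‖ξ - η‖ := by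
      calc ‖ξ‖ = ‖η + (ξ - η)‖ := by rw [add_sub_cancel]
        _ ≤ ‖η‖ + ‖ξ - η‖ := norm_add_le _ _
    linarith
  have hmax : max |t| |s| ≤ 2 * max s d := by
    rw [abs_of_nonneg ht0, abs_of_nonneg hs0]
    refine max_le ?_ ?_
    · calc t ≤ s + d := htsd
        _ ≤ max s d + max s d := add_le_add (le_max_left _ _) (le_max_right _ _)
        _ = 2 * max s d := by ring
    · calc s ≤ max s d := le_max_left _ _
        _ ≤ 2 * max s d := by
          have : 0 ≤ max s d := le_max_of_le_left hs0
          linarith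
  have h1 := abs_pow_sub_pow_le (a := t) (b := s) (n := m)
  have hmax0 : 0 ≤ max |t| |s| := le_max_of_le_left (abs_nonneg _)
  calc |t ^ m - s ^ m| ≤ |t - s| * m * max |t| |s| ^ (m - 1) := h1
    _ ≤ d * m * (2 * max s d) ^ (m - 1) := by
        gcongr
    _ = m * 2 ^ (m - 1) * (d * max s d ^ (m - 1)) := by rw [mul_pow]; ring
    _ ≤ m * 2 ^ (m - 1) * (d * (s ^ (m - 1) + d ^ (m - 1))) := by
        gcongr
        exact max_pow_le_add_pow hs0 hd0 _
    _ = m * 2 ^ (m - 1) * (d * s ^ (m - 1) + d ^ m) := by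
        congr 1
        have : d * d ^ (m - 1) = d ^ m := by
          rw [← pow_succ', Nat.sub_add_cancel hm]
        rw [mul_add, this]
    _ ≤ m * 2 ^ (m - 1) * (d * s ^ (m - 1) + (1 + d) ^ m) := by
        gcongr
        linarith

/-- The weight commutator inequality in `ℝ≥0∞`:
`‖ρ_m ξ − ρ_m η‖ₑ ≤ m 2^(m-1) (ofReal ‖ξ − η‖ · ρ_(m-1) η + ρ_m (ξ − η))`. [cite: MajdaBertozzi2002, Lemma 3.4 (3.32)] -/
theorem enorm_weight_sub_weight_le (m : ℕ) (ξ η : E) :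
    ‖(1 + ‖ξ‖) ^ m - (1 + ‖η‖) ^ m‖ₑ ≤
      (m * 2 ^ (m - 1) : ℝ≥0∞) * (ENNReal.ofReal ‖ξ - η‖ * ENNReal.ofReal ((1 + ‖η‖) ^ (m - 1)) +
        ENNReal.ofReal ((1 + ‖ξ - η‖) ^ m)) := by
  rw [Real.enorm_eq_ofReal_abs]
  refine (ENNReal.ofReal_le_ofReal (abs_weight_sub_weight_le m ξ η)).trans (le_of_eq ?_)
  rw [ENNReal.ofReal_mul (by positivity), ENNReal.ofReal_add (by positivity) (by positivity),
    ENNReal.ofReal_mul (norm_nonneg _), ENNReal.ofReal_mul (by positivity),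
    ENNReal.ofReal_pow (by norm_num), ENNReal.ofReal_ofNat, ENNReal.ofReal_natCast]

/-- `‖η‖ (1 + ‖η‖)^(m-1) ≤ (1 + ‖η‖)^m` for `m ≥ 1`, in `ℝ≥0∞`. [folklore] -/
theorem ofReal_norm_mul_weight_pred_le {m : ℕ} (hm : 1 ≤ m) (η : E) :
    ENNReal.ofReal ‖η‖ * ENNReal.ofReal ((1 + ‖η‖) ^ (m - 1)) ≤ ENNReal.ofReal ((1 + ‖η‖) ^ m) := by
  rw [← ENNReal.ofReal_mul (norm_nonneg _)]
  refine ENNReal.ofReal_le_ofReal ?_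
  calc ‖η‖ * (1 + ‖η‖) ^ (m - 1) ≤ (1 + ‖η‖) * (1 + ‖η‖) ^ (m - 1) := by
        gcongr; linarith [norm_nonneg η]
    _ = (1 + ‖η‖) ^ m := by rw [← pow_succ', Nat.sub_add_cancel hm]

end Weights

/-! ### Trilinear majorant bounds (Cauchy–Schwarz and Young) -/

section Trilinear

variable {Φ Ψ Θ : EuclideanSpace ℝ ι → ℝ≥0∞}

/-- **`∫⁻ Θ · (Φ ⋆ₗ Ψ) ≤ ‖Θ‖₂ ‖Φ‖₂ ‖Ψ‖₁`** (Cauchy–Schwarz in `ξ`, then Young's inequality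
`‖Φ ⋆ₗ Ψ‖₂ ≤ ‖Φ‖₂ ‖Ψ‖₁`): the basic trilinear bound for the transport terms, with the `L¹` norm on
the factor entering the convolution at `ξ − η`. [folklore] -/
theorem lintegral_mul_lconv_le (hΦ : AEMeasurable Φ volume) (hΨ : AEMeasurable Ψ volume)
    (hΘ : AEMeasurable Θ volume) :
    ∫⁻ ξ, Θ ξ * (Φ ⋆ₗ Ψ) ξ ≤
      (∫⁻ ξ, Θ ξ ^ 2) ^ (1 / 2 : ℝ) * (∫⁻ η, Φ η ^ 2) ^ (1 / 2 : ℝ) * ∫⁻ η, Ψ η := by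
  have hconv : AEMeasurable (fun ξ => (Φ ⋆ₗ Ψ) ξ) volume := aemeasurable_lconvolution hΦ hΨ
  have hCS := ENNReal.lintegral_mul_le_Lp_mul_Lq volume (Real.HolderConjugate.two_two) hΘ hconv
  simp only [Pi.mul_apply] at hCS
  rw [lintegral_rpow_two_eq, lintegral_rpow_two_eq] at hCS
  refine hCS.trans ?_
  have hY : (∫⁻ ξ, (Φ ⋆ₗ Ψ) ξ ^ 2) ^ (1 / 2 : ℝ) ≤ (∫⁻ η, Φ η ^ 2) ^ (1 / 2 : ℝ) * ∫⁻ η, Ψ η := by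
    calc (∫⁻ ξ, (Φ ⋆ₗ Ψ) ξ ^ 2) ^ (1 / 2 : ℝ)
        ≤ ((∫⁻ η, Ψ η) ^ 2 * ∫⁻ η, Φ η ^ 2) ^ (1 / 2 : ℝ) :=
          ENNReal.rpow_le_rpow (lintegral_lconv_sq_le hΦ hΨ) (by norm_num)
      _ = (∫⁻ η, Φ η ^ 2) ^ (1 / 2 : ℝ) * ∫⁻ η, Ψ η := by
          rw [ENNReal.mul_rpow_of_nonneg _ _ (by norm_num), ← ENNReal.rpow_natCast,
            ← ENNReal.rpow_mul]
          norm_num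
          rw [mul_comm]
  calc (∫⁻ ξ, Θ ξ ^ 2) ^ (1 / 2 : ℝ) * (∫⁻ ξ, (Φ ⋆ₗ Ψ) ξ ^ 2) ^ (1 / 2 : ℝ)
      ≤ (∫⁻ ξ, Θ ξ ^ 2) ^ (1 / 2 : ℝ) * ((∫⁻ η, Φ η ^ 2) ^ (1 / 2 : ℝ) * ∫⁻ η, Ψ η) := by
        gcongr
    _ = _ := by rw [mul_assoc]

/-- The same bound with the roles exchanged by commutativity of `⋆ₗ`:
`∫⁻ Θ · (Φ ⋆ₗ Ψ) ≤ ‖Θ‖₂ ‖Φ‖₁ ‖Ψ‖₂` (the `L¹` norm on the factor at `η`). [folklore] -/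
theorem lintegral_mul_lconv_le' (hΦ : AEMeasurable Φ volume) (hΨ : AEMeasurable Ψ volume)
    (hΘ : AEMeasurable Θ volume) :
    ∫⁻ ξ, Θ ξ * (Φ ⋆ₗ Ψ) ξ ≤
      (∫⁻ ξ, Θ ξ ^ 2) ^ (1 / 2 : ℝ) * (∫⁻ η, Ψ η ^ 2) ^ (1 / 2 : ℝ) * ∫⁻ η, Φ η := by
  rw [lconvolution_comm]
  exact lintegral_mul_lconv_le hΨ hΦ hΘ

end Trilinear

/-! ### The transport kernel `η_j f(ξ − η) g(η) conj h(ξ)` on frequency space squared -/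

section Kernel

variable {f g h : EuclideanSpace ℝ ι → ℂ}

omit [Fintype ι] in
/-- `‖(η_j : ℂ)‖ₑ ≤ ofReal ‖η‖`. [folklore] -/
theorem enorm_coord_le [Fintype ι] (η : EuclideanSpace ℝ ι) (j : ι) :
    ‖((η j : ℝ) : ℂ)‖ₑ ≤ ENNReal.ofReal ‖η‖ := by
  rw [← ofReal_norm, Complex.norm_real, Real.norm_eq_abs]
  exact ENNReal.ofReal_le_ofReal (abs_apply_le_norm η j)

/-- Measurability of the transport kernel on `E × E`. [folklore] -/
theorem aestronglyMeasurable_transportKernel (hf : AEStronglyMeasurable f volume)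
    (hg : AEStronglyMeasurable g volume) (hh : AEStronglyMeasurable h volume) (j : ι) :
    AEStronglyMeasurable (fun p : EuclideanSpace ℝ ι × EuclideanSpace ℝ ι =>
      ((p.2 j : ℝ) : ℂ) * f (p.1 - p.2) * (g p.2 * conj (h p.1))) (volume.prod volume) := by
  have h1 : AEStronglyMeasurable (fun p : EuclideanSpace ℝ ι × EuclideanSpace ℝ ι =>
      ((p.2 j : ℝ) : ℂ)) (volume.prod volume) :=
    (Complex.continuous_ofReal.comp ((EuclideanSpace.proj j).continuous.comp
      continuous_snd)).aestronglyMeasurable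
  have h2 : AEStronglyMeasurable (fun p : EuclideanSpace ℝ ι × EuclideanSpace ℝ ι =>
      f (p.1 - p.2)) (volume.prod volume) :=
    hf.comp_quasiMeasurePreserving (quasiMeasurePreserving_sub volume volume)
  have h3 : AEStronglyMeasurable (fun p : EuclideanSpace ℝ ι × EuclideanSpace ℝ ι => g p.2)
      (volume.prod volume) := hg.comp_snd
  have h4 : AEStronglyMeasurable (fun p : EuclideanSpace ℝ ι × EuclideanSpace ℝ ι =>
      conj (h p.1)) (volume.prod volume) :=
    (Complex.continuous_conj.comp_aestronglyMeasurable hh).comp_fst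
  exact (h1.mul h2).mul (h3.mul h4)

/-- **Integrability of the transport kernel** `(ξ, η) ↦ η_j f(ξ − η) g(η) conj h(ξ)` on `E × E`
for `f ∈ L¹`, `‖·‖ g ∈ L²`, `h ∈ L²`: Tonelli and the trilinear bound
`∫∫ ‖η‖ |f(ξ − η)| |g(η)| |h(ξ)| ≤ ‖h‖₂ ‖‖·‖g‖₂ ‖f‖₁`. [folklore] -/
theorem integrable_transportKernel (hf : Integrable f) (hg : AEStronglyMeasurable g volume)
    (hg2 : ∫⁻ η, (ENNReal.ofReal ‖η‖ * ‖g η‖ₑ) ^ 2 < ⊤) (hh : MemLp h 2 volume) (j : ι) :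
    Integrable (fun p : EuclideanSpace ℝ ι × EuclideanSpace ℝ ι =>
      ((p.2 j : ℝ) : ℂ) * f (p.1 - p.2) * (g p.2 * conj (h p.1))) (volume.prod volume) := by
  refine ⟨aestronglyMeasurable_transportKernel hf.1 hg hh.1 j, ?_⟩
  -- the majorant `B(ξ, η) = ‖η‖ |f(ξ-η)| |g(η)| |h(ξ)|`
  set Φ : EuclideanSpace ℝ ι → ℝ≥0∞ := fun η => ENNReal.ofReal ‖η‖ * ‖g η‖ₑ with hΦ
  set Ψ : EuclideanSpace ℝ ι → ℝ≥0∞ := fun ζ => ‖f ζ‖ₑ with hΨ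
  set Θ : EuclideanSpace ℝ ι → ℝ≥0∞ := fun ξ => ‖h ξ‖ₑ with hΘ
  have hΦm : AEMeasurable Φ volume :=
    (ENNReal.continuous_ofReal.comp continuous_norm).measurable.aemeasurable.mul hg.enorm
  have hΨm : AEMeasurable Ψ volume := hf.1.enorm
  have hΘm : AEMeasurable Θ volume := hh.1.enorm
  have hB : AEMeasurable (fun p : EuclideanSpace ℝ ι × EuclideanSpace ℝ ι =>
      Θ p.1 * (Φ p.2 * Ψ (p.1 - p.2))) (volume.prod volume) := by
    refine (hΘm.comp_quasiMeasurePreserving Measure.quasiMeasurePreserving_fst).mul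
      ((hΦm.comp_quasiMeasurePreserving Measure.quasiMeasurePreserving_snd).mul ?_)
    exact hΨm.comp_quasiMeasurePreserving (quasiMeasurePreserving_sub volume volume)
  have hle : ∀ p : EuclideanSpace ℝ ι × EuclideanSpace ℝ ι,
      ‖((p.2 j : ℝ) : ℂ) * f (p.1 - p.2) * (g p.2 * conj (h p.1))‖ₑ ≤
        Θ p.1 * (Φ p.2 * Ψ (p.1 - p.2)) := by
    intro p
    rw [enorm_mul, enorm_mul, enorm_mul, RCLike.enorm_conj]
    calc ‖((p.2 j : ℝ) : ℂ)‖ₑ * ‖f (p.1 - p.2)‖ₑ * (‖g p.2‖ₑ * ‖h p.1‖ₑ)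
        ≤ ENNReal.ofReal ‖p.2‖ * ‖f (p.1 - p.2)‖ₑ * (‖g p.2‖ₑ * ‖h p.1‖ₑ) := by
          gcongr; exact enorm_coord_le p.2 j
      _ = Θ p.1 * (Φ p.2 * Ψ (p.1 - p.2)) := by simp only [hΘ, hΦ, hΨ]; ring
  refine lt_of_le_of_lt (lintegral_mono hle) ?_
  rw [lintegral_prod _ hB]
  have hinner : ∀ ξ, ∫⁻ η, Θ ξ * (Φ η * Ψ (ξ - η)) = Θ ξ * (Φ ⋆ₗ Ψ) ξ := fun ξ => by
    rw [lintegral_const_mul' _ _ enorm_ne_top, lconv_apply]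
  simp_rw [hinner]
  refine lt_of_le_of_lt (lintegral_mul_lconv_le hΦm hΨm hΘm) ?_
  refine ENNReal.mul_lt_top (ENNReal.mul_lt_top ?_ ?_) hf.2
  · rw [hΘ, lintegral_enorm_sq_rpow_half_eq_eLpNorm]; exact hh.eLpNorm_lt_top
  · exact ENNReal.rpow_lt_top_of_nonneg (by norm_num) hg2.ne

end Kernel

/-! ### The transport form and its conjugation symmetry (the energy cancellation) -/

section Cancellation

variable {v G : EuclideanSpace ℝ ι → ι → ℂ}

/-- **Integrability of the transport form** `(ξ, η) ↦ ∑_{j,k} η_j v_j(ξ − η) G_k(η) conj G_k(ξ)`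
on `E × E`, for `v ∈ L¹` and `G`, `‖·‖ G ∈ L²` componentwise. [folklore] -/
theorem integrable_transportForm
    (hv1 : ∀ j, Integrable (fun ζ => v ζ j) volume) (hG : AEStronglyMeasurable G volume)
    (hG2 : ∀ k, MemLp (fun η => G η k) 2 volume)
    (hGw : ∀ k, MemLp (fun η => ((‖η‖ : ℝ) : ℂ) * G η k) 2 volume) :
    Integrable (fun p : EuclideanSpace ℝ ι × EuclideanSpace ℝ ι =>
      ∑ j, ∑ k, ((p.2 j : ℝ) : ℂ) * v (p.1 - p.2) j * (G p.2 k * conj (G p.1 k)))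
      (volume.prod volume) := by
  refine integrable_finsetSum _ fun j _ => integrable_finsetSum _ fun k _ => ?_
  refine integrable_transportKernel (hv1 j) (aesm_apply hG k) ?_ (hG2 k) j
  have h : ∫⁻ η, ‖((‖η‖ : ℝ) : ℂ) * G η k‖ₑ ^ 2 < ⊤ := by
    rw [lintegral_enorm_sq_eq_eLpNorm_sq]; exact ENNReal.pow_lt_top (hGw k).eLpNorm_lt_top
  refine lt_of_le_of_lt (le_of_eq (lintegral_congr fun η => ?_)) h
  rw [enorm_mul, ← ofReal_norm (((‖η‖ : ℝ) : ℂ)), Complex.norm_real, Real.norm_eq_abs, abs_norm]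

/-- **Conjugation symmetry of the transport form.** If `v` is divergence free
(`∑_j ζ_j v_j(ζ) = 0`) and conjugation symmetric (`v(-ζ) = conj v(ζ)`) almost everywhere, then
`conj F(ξ, η) = F(η, ξ)` for a.e. `(ξ, η)`, where
`F(ξ, η) = ∑_{j,k} η_j v_j(ξ − η) G_k(η) conj G_k(ξ)`: indeed `conj v_j(ξ − η) = v_j(η − ξ)` and the
difference `∑_j (ξ − η)_j conj v_j(ξ − η) · ∑_k G_k(ξ) conj G_k(η)` vanishes by incompressibility. This
is the Fourier-side form of `∫ (u·∇)w · w = -½ ∫ (div u)|w|² = 0` (Majda–Bertozzi 2002, proof of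
Prop. 3.7, p. 105: "the divergence theorem implies …`= 0`"). [cite: MajdaBertozzi2002, Prop. 3.7 proof] -/
theorem conj_transportForm_ae (hdiv : ∀ᵐ ζ ∂(volume : Measure (EuclideanSpace ℝ ι)),
      ∑ j, ((ζ j : ℝ) : ℂ) * v ζ j = 0)
    (hsym : ∀ᵐ ζ ∂(volume : Measure (EuclideanSpace ℝ ι)), ∀ j, v (-ζ) j = conj (v ζ j)) :
    ∀ᵐ p : EuclideanSpace ℝ ι × EuclideanSpace ℝ ι ∂(volume.prod volume),
      conj (∑ j, ∑ k, ((p.2 j : ℝ) : ℂ) * v (p.1 - p.2) j * (G p.2 k * conj (G p.1 k))) =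
        ∑ j, ∑ k, ((p.1 j : ℝ) : ℂ) * v (p.2 - p.1) j * (G p.1 k * conj (G p.2 k)) := by
  have h := (quasiMeasurePreserving_sub (volume : Measure (EuclideanSpace ℝ ι)) volume).ae
    (hdiv.and hsym)
  filter_upwards [h] with p hp
  obtain ⟨hd, hs⟩ := hp
  -- `v (p.2 - p.1) = conj (v (p.1 - p.2))`
  have hs' : ∀ j, v (p.2 - p.1) j = conj (v (p.1 - p.2) j) := fun j => by
    rw [← neg_sub p.1 p.2]; exact hs j
  simp only [map_sum, map_mul, Complex.conj_ofReal, Complex.conj_conj, hs']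
  -- factor both sides
  rw [show (∑ j, ∑ k, ((p.2 j : ℝ) : ℂ) * conj (v (p.1 - p.2) j) * (conj (G p.2 k) * G p.1 k)) =
      (∑ j, ((p.2 j : ℝ) : ℂ) * conj (v (p.1 - p.2) j)) * ∑ k, conj (G p.2 k) * G p.1 k from
      by rw [Finset.sum_mul_sum],
    show (∑ j, ∑ k, ((p.1 j : ℝ) : ℂ) * conj (v (p.1 - p.2) j) * (G p.1 k * conj (G p.2 k))) =
      (∑ j, ((p.1 j : ℝ) : ℂ) * conj (v (p.1 - p.2) j)) * ∑ k, G p.1 k * conj (G p.2 k) from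
      by rw [Finset.sum_mul_sum]]
  have hk : ∑ k, conj (G p.2 k) * G p.1 k = ∑ k, G p.1 k * conj (G p.2 k) :=
    Finset.sum_congr rfl fun k _ => mul_comm _ _
  have hj : ∑ j, ((p.1 j : ℝ) : ℂ) * conj (v (p.1 - p.2) j) =
      ∑ j, ((p.2 j : ℝ) : ℂ) * conj (v (p.1 - p.2) j) := by
    rw [← sub_eq_zero, ← Finset.sum_sub_distrib]
    have : ∑ j, (((p.1 j : ℝ) : ℂ) * conj (v (p.1 - p.2) j) - ((p.2 j : ℝ) : ℂ) * conj (v (p.1 - p.2) j)) =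
        conj (∑ j, (((p.1 - p.2) j : ℝ) : ℂ) * v (p.1 - p.2) j) := by
      rw [map_sum]
      refine Finset.sum_congr rfl fun j _ => ?_
      rw [map_mul, Complex.conj_ofReal, PiLp.sub_apply, Complex.ofReal_sub, sub_mul]
    rw [this, hd, map_zero]
  rw [hk, hj]

/-- **The transport form is real**: under the hypotheses of `integrable_transportForm` and
`conj_transportForm_ae`, `S = ∫∫ ∑_{j,k} η_j v_j(ξ − η) G_k(η) conj G_k(ξ) dη dξ` satisfies
`conj S = S` (conjugate, use the a.e. symmetry, and swap the order of integration by Fubini).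
[cite: MajdaBertozzi2002, Prop. 3.7 proof] -/
theorem conj_integral_transportForm
    (hv1 : ∀ j, Integrable (fun ζ => v ζ j) volume) (hG : AEStronglyMeasurable G volume)
    (hG2 : ∀ k, MemLp (fun η => G η k) 2 volume)
    (hGw : ∀ k, MemLp (fun η => ((‖η‖ : ℝ) : ℂ) * G η k) 2 volume)
    (hdiv : ∀ᵐ ζ ∂(volume : Measure (EuclideanSpace ℝ ι)), ∑ j, ((ζ j : ℝ) : ℂ) * v ζ j = 0)
    (hsym : ∀ᵐ ζ ∂(volume : Measure (EuclideanSpace ℝ ι)), ∀ j, v (-ζ) j = conj (v ζ j)) :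
    conj (∫ ξ, ∫ η, ∑ j, ∑ k, ((η j : ℝ) : ℂ) * v (ξ - η) j * (G η k * conj (G ξ k))) =
      ∫ ξ, ∫ η, ∑ j, ∑ k, ((η j : ℝ) : ℂ) * v (ξ - η) j * (G η k * conj (G ξ k)) := by
  set F : EuclideanSpace ℝ ι × EuclideanSpace ℝ ι → ℂ := fun p =>
    ∑ j, ∑ k, ((p.2 j : ℝ) : ℂ) * v (p.1 - p.2) j * (G p.2 k * conj (G p.1 k)) with hF
  have hint : Integrable F (volume.prod volume) := integrable_transportForm hv1 hG hG2 hGw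
  have hsymm : ∀ᵐ p : EuclideanSpace ℝ ι × EuclideanSpace ℝ ι ∂(volume.prod volume),
      conj (F p) = F p.swap := by
    simpa only [hF, Prod.fst_swap, Prod.snd_swap] using conj_transportForm_ae (G := G) hdiv hsym
  change conj (∫ ξ, ∫ η, F (ξ, η)) = ∫ ξ, ∫ η, F (ξ, η)
  rw [← integral_conj]
  simp_rw [← integral_conj]
  have h1 : (fun ξ => ∫ η, conj (F (ξ, η))) =ᵐ[volume] fun ξ => ∫ η, F (η, ξ) := by
    filter_upwards [Measure.ae_ae_of_ae_prod hsymm] with ξ hξ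
    exact integral_congr_ae hξ
  rw [integral_congr_ae h1]
  exact integral_integral_swap hint.swap

/-- **The energy cancellation, scalar form**: `Im ∫∫ ∑_{j,k} η_j v_j(ξ − η) G_k(η) conj G_k(ξ) = 0`.
[cite: MajdaBertozzi2002, Prop. 3.7 proof] -/
theorem im_integral_transportForm_eq_zero
    (hv1 : ∀ j, Integrable (fun ζ => v ζ j) volume) (hG : AEStronglyMeasurable G volume)
    (hG2 : ∀ k, MemLp (fun η => G η k) 2 volume)
    (hGw : ∀ k, MemLp (fun η => ((‖η‖ : ℝ) : ℂ) * G η k) 2 volume)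
    (hdiv : ∀ᵐ ζ ∂(volume : Measure (EuclideanSpace ℝ ι)), ∑ j, ((ζ j : ℝ) : ℂ) * v ζ j = 0)
    (hsym : ∀ᵐ ζ ∂(volume : Measure (EuclideanSpace ℝ ι)), ∀ j, v (-ζ) j = conj (v ζ j)) :
    (∫ ξ, ∫ η, ∑ j, ∑ k, ((η j : ℝ) : ℂ) * v (ξ - η) j * (G η k * conj (G ξ k))).im = 0 :=
  Complex.conj_eq_iff_im.1 (conj_integral_transportForm hv1 hG hG2 hGw hdiv hsym)

end Cancellation

/-! ### From the projected nonlinearity `nonlin` to the transport form -/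

section Nonlin

variable [DecidableEq ι]
variable {v W G : EuclideanSpace ℝ ι → ι → ℂ}

/-- **The Leray projector is self-adjoint and fixes divergence-free vectors**, coordinate form:
if `∑_l ξ_l g_l = 0` then `∑_l m_{jkl}(ξ) conj g_l = ξ_j conj g_k` for the projected derivative symbol
`m_{jkl}(ξ) = ξ_j (δ_{kl} − ξ_k ξ_l / ‖ξ‖²)`. [folklore] -/
theorem sum_lerayDerivSymbol_mul_conj {g : ι → ℂ} (ξ : EuclideanSpace ℝ ι)
    (hg : ∑ l, ((ξ l : ℝ) : ℂ) * g l = 0) (j k : ι) :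
    ∑ l, (lerayDerivSymbol j k l ξ : ℂ) * conj (g l) = ((ξ j : ℝ) : ℂ) * conj (g k) := by
  have hg' : ∑ l, ((ξ l : ℝ) : ℂ) * conj (g l) = 0 := by
    have := congrArg conj hg
    rw [map_sum, map_zero] at this
    simpa only [map_mul, Complex.conj_ofReal] using this
  have hsplit : ∀ l, (lerayDerivSymbol j k l ξ : ℂ) * conj (g l) =
      ((ξ j : ℝ) : ℂ) * ((if k = l then 1 else 0) * conj (g l)) -
        ((ξ j * ξ k / ‖ξ‖ ^ 2 : ℝ) : ℂ) * (((ξ l : ℝ) : ℂ) * conj (g l)) := by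
    intro l
    rw [lerayDerivSymbol_apply]
    split_ifs <;> push_cast <;> ring
  rw [Finset.sum_congr rfl fun l _ => hsplit l, Finset.sum_sub_distrib, ← Finset.mul_sum,
    ← Finset.mul_sum, hg', mul_zero, sub_zero]
  congr 1
  simp only [ite_mul, one_mul, zero_mul, Finset.sum_ite_eq, Finset.mem_univ, if_true]

/-- **Pairing the projected nonlinearity with a divergence-free field**: at a frequency `ξ` with
`∑_l ξ_l G_l(ξ) = 0`,
`∑_l N(v, W)(ξ)_l conj G_l(ξ) = -2πi ∑_{j,k} ξ_j (v_j ⋆ W_k)(ξ) conj G_k(ξ)` — the projector drops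
out (`(ℙf, g) = (f, g)` for `div g = 0`). [folklore] -/
theorem sum_nonlin_mul_conj_eq (v W : EuclideanSpace ℝ ι → ι → ℂ) {G : EuclideanSpace ℝ ι → ι → ℂ}
    (ξ : EuclideanSpace ℝ ι) (hG : ∑ l, ((ξ l : ℝ) : ℂ) * G ξ l = 0) :
    ∑ l, nonlin v W ξ l * conj (G ξ l) =
      -(2 * π * Complex.I) * ∑ j, ∑ k, ((ξ j : ℝ) : ℂ) * fconv (v · j) (W · k) ξ * conj (G ξ k) := by
  simp only [nonlin_apply]
  set C : ι → ι → ℂ := fun j k => fconv (v · j) (W · k) ξ with hC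
  have h1 : ∀ l, -(2 * π * Complex.I) * (∑ j, ∑ k, (lerayDerivSymbol j k l ξ : ℂ) * C j k) *
      conj (G ξ l) =
      -(2 * π * Complex.I) * ∑ j, ∑ k, C j k * ((lerayDerivSymbol j k l ξ : ℂ) * conj (G ξ l)) := by
    intro l
    rw [mul_assoc, Finset.sum_mul]
    congr 1
    refine Finset.sum_congr rfl fun j _ => ?_
    rw [Finset.sum_mul]
    exact Finset.sum_congr rfl fun k _ => by ring
  rw [Finset.sum_congr rfl fun l _ => h1 l, ← Finset.mul_sum]
  congr 1
  rw [Finset.sum_comm]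
  refine Finset.sum_congr rfl fun j _ => ?_
  rw [Finset.sum_comm]
  refine Finset.sum_congr rfl fun k _ => ?_
  rw [← Finset.mul_sum, sum_lerayDerivSymbol_mul_conj ξ hG j k]
  ring

omit [DecidableEq ι] in
/-- The frequency convolution in the `ξ − η` form: `(f ⋆ g)(ξ) = ∫ f(ξ − η) g(η) dη`. [folklore] -/
theorem fconv_eq_integral_sub (f g : EuclideanSpace ℝ ι → ℂ) (ξ : EuclideanSpace ℝ ι) :
    fconv f g ξ = ∫ η, f (ξ - η) * g η := by
  rw [fconv_apply]
  have h := integral_sub_left_eq_self (fun η => f η * g (ξ - η))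
    (volume : Measure (EuclideanSpace ℝ ι)) ξ
  simp only [sub_sub_cancel] at h
  exact h.symm

omit [DecidableEq ι] in
/-- **Incompressibility moves the derivative onto the transported factor**: for `v` divergence
free a.e., `∑_j ξ_j (v_j ⋆ W_k)(ξ) = ∫ ∑_j η_j v_j(ξ − η) W_k(η) dη` at every frequency `ξ`
(`ξ_j = (ξ − η)_j + η_j` and `∑_j (ξ − η)_j v_j(ξ − η) = 0`); here `v_j, W_k ∈ L²` and `‖·‖ W_k ∈ L²`.
[folklore] -/
theorem sum_coord_mul_fconv_eq_integral
    (hdiv : ∀ᵐ ζ ∂(volume : Measure (EuclideanSpace ℝ ι)), ∑ j, ((ζ j : ℝ) : ℂ) * v ζ j = 0)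
    (hv2 : ∀ j, MemLp (fun ζ => v ζ j) 2 volume) {k : ι} (hW2 : MemLp (fun η => W η k) 2 volume)
    (hWw : MemLp (fun η => ((‖η‖ : ℝ) : ℂ) * W η k) 2 volume) (ξ : EuclideanSpace ℝ ι) :
    ∑ j, ((ξ j : ℝ) : ℂ) * fconv (v · j) (W · k) ξ =
      ∫ η, ∑ j, ((η j : ℝ) : ℂ) * v (ξ - η) j * W η k := by
  -- integrability of the two integrands
  have hI1 : ∀ j, Integrable (fun η => v (ξ - η) j * W η k) volume := fun j => by
    have h := (memLp_comp_sub_left (hv2 j) ξ).integrable_mul hW2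
    exact h
  have hWj : ∀ j, MemLp (fun η => ((η j : ℝ) : ℂ) * W η k) 2 volume := fun j => by
    refine MemLp.of_le_mul (c := 1) hWw ?_ (Eventually.of_forall fun η => ?_)
    · exact ((Complex.continuous_ofReal.comp (EuclideanSpace.proj j).continuous).aestronglyMeasurable).mul hW2.1
    · rw [one_mul, norm_mul, norm_mul, Complex.norm_real, Complex.norm_real, Real.norm_eq_abs,
        Real.norm_eq_abs, abs_norm]
      exact mul_le_mul_of_nonneg_right (abs_apply_le_norm η j) (norm_nonneg _)
  have hI2 : ∀ j, Integrable (fun η => ((η j : ℝ) : ℂ) * v (ξ - η) j * W η k) volume := fun j => by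
    have h := (memLp_comp_sub_left (hv2 j) ξ).integrable_mul (hWj j)
    refine h.congr (Eventually.of_forall fun η => ?_)
    simp only [Pi.mul_apply]; ring
  -- the shift
  have hdiv' : ∀ᵐ η ∂(volume : Measure (EuclideanSpace ℝ ι)),
      ∑ j, (((ξ - η) j : ℝ) : ℂ) * v (ξ - η) j = 0 :=
    (Measure.measurePreserving_sub_left volume ξ).quasiMeasurePreserving.ae hdiv
  calc ∑ j, ((ξ j : ℝ) : ℂ) * fconv (v · j) (W · k) ξ
      = ∑ j, ∫ η, ((ξ j : ℝ) : ℂ) * (v (ξ - η) j * W η k) := by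
        refine Finset.sum_congr rfl fun j _ => ?_
        rw [fconv_eq_integral_sub, ← integral_const_mul]
    _ = ∫ η, ∑ j, ((ξ j : ℝ) : ℂ) * (v (ξ - η) j * W η k) := by
        rw [integral_finsetSum _ fun j _ => (hI1 j).const_mul _]
    _ = ∫ η, ∑ j, ((η j : ℝ) : ℂ) * v (ξ - η) j * W η k := by
        refine integral_congr_ae ?_
        filter_upwards [hdiv'] with η hη
        have : ∑ j, ((ξ j : ℝ) : ℂ) * (v (ξ - η) j * W η k) =
            (∑ j, (((ξ - η) j : ℝ) : ℂ) * v (ξ - η) j) * W η k +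
              ∑ j, ((η j : ℝ) : ℂ) * v (ξ - η) j * W η k := by
          rw [Finset.sum_mul, ← Finset.sum_add_distrib]
          refine Finset.sum_congr rfl fun j _ => ?_
          rw [PiLp.sub_apply, Complex.ofReal_sub]
          ring
        rw [this, hη, zero_mul, zero_add]

/-- **The paired nonlinearity as a transport form**: for `v` divergence free a.e. (`v_j ∈ L²`),
a transported field `W` (`W_k`, `‖·‖ W_k ∈ L²`) and a pairing field `G` divergence free a.e.,
`∫ ∑_l N(v, W)(ξ)_l conj G_l(ξ) dξ = -2πi ∫∫ ∑_{j,k} η_j v_j(ξ − η) W_k(η) conj G_k(ξ) dη dξ`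
(both sides are integrals over `ξ` of a.e. equal functions; no integrability in `ξ` is needed).
[folklore] -/
theorem integral_sum_nonlin_mul_conj_eq
    (hvdiv : ∀ᵐ ζ ∂(volume : Measure (EuclideanSpace ℝ ι)), ∑ j, ((ζ j : ℝ) : ℂ) * v ζ j = 0)
    (hv2 : ∀ j, MemLp (fun ζ => v ζ j) 2 volume)
    (hW2 : ∀ k, MemLp (fun η => W η k) 2 volume)
    (hWw : ∀ k, MemLp (fun η => ((‖η‖ : ℝ) : ℂ) * W η k) 2 volume)
    (hGdiv : ∀ᵐ ξ ∂(volume : Measure (EuclideanSpace ℝ ι)), ∑ l, ((ξ l : ℝ) : ℂ) * G ξ l = 0) :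
    ∫ ξ, ∑ l, nonlin v W ξ l * conj (G ξ l) =
      -(2 * π * Complex.I) *
        ∫ ξ, ∫ η, ∑ j, ∑ k, ((η j : ℝ) : ℂ) * v (ξ - η) j * (W η k * conj (G ξ k)) := by
  rw [← integral_const_mul]
  refine integral_congr_ae ?_
  filter_upwards [hGdiv] with ξ hξ
  have hI : ∀ j k, Integrable (fun η => ((η j : ℝ) : ℂ) * v (ξ - η) j * W η k) volume := by
    intro j k
    have hWj : MemLp (fun η => ((η j : ℝ) : ℂ) * W η k) 2 volume := by
      refine MemLp.of_le_mul (c := 1) (hWw k) ?_ (Eventually.of_forall fun η => ?_)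
      · exact ((Complex.continuous_ofReal.comp (EuclideanSpace.proj j).continuous).aestronglyMeasurable).mul (hW2 k).1
      · rw [one_mul, norm_mul, norm_mul, Complex.norm_real, Complex.norm_real, Real.norm_eq_abs,
          Real.norm_eq_abs, abs_norm]
        exact mul_le_mul_of_nonneg_right (abs_apply_le_norm η j) (norm_nonneg _)
    have h := (memLp_comp_sub_left (hv2 j) ξ).integrable_mul hWj
    refine h.congr (Eventually.of_forall fun η => ?_)
    simp only [Pi.mul_apply]; ring
  rw [sum_nonlin_mul_conj_eq v W ξ hξ]
  congr 1
  calc ∑ j, ∑ k, ((ξ j : ℝ) : ℂ) * fconv (v · j) (W · k) ξ * conj (G ξ k)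
      = ∑ k, (∑ j, ((ξ j : ℝ) : ℂ) * fconv (v · j) (W · k) ξ) * conj (G ξ k) := by
        rw [Finset.sum_comm]
        simp_rw [Finset.sum_mul]
    _ = ∑ k, (∫ η, ∑ j, ((η j : ℝ) : ℂ) * v (ξ - η) j * W η k) * conj (G ξ k) := by
        refine Finset.sum_congr rfl fun k _ => ?_
        rw [sum_coord_mul_fconv_eq_integral hvdiv hv2 (hW2 k) (hWw k) ξ]
    _ = ∫ η, ∑ k, (∑ j, ((η j : ℝ) : ℂ) * v (ξ - η) j * W η k) * conj (G ξ k) := by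
        simp_rw [← integral_mul_const]
        rw [integral_finsetSum _ fun k _ => ?_]
        exact (integrable_finsetSum _ fun j _ => hI j k).mul_const _
    _ = ∫ η, ∑ j, ∑ k, ((η j : ℝ) : ℂ) * v (ξ - η) j * (W η k * conj (G ξ k)) := by
        refine integral_congr_ae (Eventually.of_forall fun η => ?_)
        simp only
        rw [Finset.sum_comm]
        simp_rw [Finset.sum_mul]
        refine Finset.sum_congr rfl fun k _ => Finset.sum_congr rfl fun j _ => ?_
        ring

/-- **The energy cancellation** (Majda–Bertozzi 2002, the identity
`{P J[(Jv)·∇(D^α Jv)], D^α v} = -½ (div Jv, |J D^α v|²) = 0` in the proof of Prop. 3.7, p. 105, and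
the same at order zero in the proof of (3.53), p. 103), on the Fourier side: for a transporting
field `v` that is divergence free and conjugation symmetric a.e. (componentwise in `L¹ ∩ L²`) and a
transported field `G` that is divergence free a.e. (with `G_k`, `‖·‖ G_k ∈ L²`),
`Re ∫ ∑_l N(v, G)(ξ)_l conj G_l(ξ) dξ = 0`. [cite: MajdaBertozzi2002, Prop. 3.7 proof] -/
theorem re_integral_sum_nonlin_mul_conj_eq_zero
    (hvdiv : ∀ᵐ ζ ∂(volume : Measure (EuclideanSpace ℝ ι)), ∑ j, ((ζ j : ℝ) : ℂ) * v ζ j = 0)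
    (hvsym : ∀ᵐ ζ ∂(volume : Measure (EuclideanSpace ℝ ι)), ∀ j, v (-ζ) j = conj (v ζ j))
    (hv1 : ∀ j, Integrable (fun ζ => v ζ j) volume) (hv2 : ∀ j, MemLp (fun ζ => v ζ j) 2 volume)
    (hG : AEStronglyMeasurable G volume) (hG2 : ∀ k, MemLp (fun η => G η k) 2 volume)
    (hGw : ∀ k, MemLp (fun η => ((‖η‖ : ℝ) : ℂ) * G η k) 2 volume)
    (hGdiv : ∀ᵐ ξ ∂(volume : Measure (EuclideanSpace ℝ ι)), ∑ l, ((ξ l : ℝ) : ℂ) * G ξ l = 0) :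
    (∫ ξ, ∑ l, nonlin v G ξ l * conj (G ξ l)).re = 0 := by
  rw [integral_sum_nonlin_mul_conj_eq hvdiv hv2 hG2 hGw hGdiv]
  have hS := im_integral_transportForm_eq_zero (G := G) hv1 hG hG2 hGw hvdiv hvsym
  simp [Complex.mul_re, hS]

end Nonlin

/-! ### Pointwise bound of the nonlinearity with the derivative on the transported factor -/

section NonlinBound

variable [DecidableEq ι]
variable {v W : EuclideanSpace ℝ ι → ι → ℂ}

/-- Factorisation of the projected derivative symbol: `m_{jkl}(ξ) = ξ_j · P_{kl}(ξ)` with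
`|P_{kl}(ξ)| ≤ 2`. [folklore] -/
theorem lerayDerivSymbol_eq_mul_entry (j k l : ι) (ξ : EuclideanSpace ℝ ι) :
    (lerayDerivSymbol j k l ξ : ℂ) =
      ((ξ j : ℝ) : ℂ) * (((if k = l then (1 : ℝ) else 0) - ξ k * ξ l / ‖ξ‖ ^ 2 : ℝ) : ℂ) := by
  rw [lerayDerivSymbol_apply]; push_cast; ring

/-- **Pointwise bound of `N(v, W)` for a divergence-free transporting field**, with the
derivative carried by the transported factor (`(u·∇)w` rather than `∇·(u ⊗ w)`): for `v` divergence
free a.e. (`v_j ∈ L²`) and `W_k`, `‖·‖ W_k ∈ L²`,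
`‖N(v, W)(ξ)_l‖ₑ ≤ 4π ∑_{j,k} ((‖·‖|W_k|) ⋆ₗ |v_j|)(ξ)` at every `ξ`. This is the bound behind the
terms `R3`, `R2`, `R4` of Majda–Bertozzi 2002, proof of Lemma 3.7 (3.61), where only `‖∇v‖`-type
quantities of the transported field and no derivative of the transporting field appear.
[cite: MajdaBertozzi2002, Lemma 3.7 proof (3.61)] -/
theorem enorm_nonlin_le_of_divFree
    (hdiv : ∀ᵐ ζ ∂(volume : Measure (EuclideanSpace ℝ ι)), ∑ j, ((ζ j : ℝ) : ℂ) * v ζ j = 0)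
    (hv2 : ∀ j, MemLp (fun ζ => v ζ j) 2 volume) (hW2 : ∀ k, MemLp (fun η => W η k) 2 volume)
    (hWw : ∀ k, MemLp (fun η => ((‖η‖ : ℝ) : ℂ) * W η k) 2 volume) (ξ : EuclideanSpace ℝ ι) (l : ι) :
    ‖nonlin v W ξ l‖ₑ ≤ ENNReal.ofReal (4 * π) *
      ∑ j, ∑ k, ((fun η => ENNReal.ofReal ‖η‖ * ‖W η k‖ₑ) ⋆ₗ (fun ζ => ‖v ζ j‖ₑ)) ξ := by
  -- `N_l = -2πi ∑_k P_{kl} (∑_j ξ_j (v_j ⋆ W_k))`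
  have h1 : nonlin v W ξ l = -(2 * π * Complex.I) *
      ∑ k, (((if k = l then (1 : ℝ) else 0) - ξ k * ξ l / ‖ξ‖ ^ 2 : ℝ) : ℂ) *
        ∑ j, ((ξ j : ℝ) : ℂ) * fconv (v · j) (W · k) ξ := by
    rw [nonlin_apply, Finset.sum_comm]
    congr 1
    refine Finset.sum_congr rfl fun k _ => ?_
    rw [Finset.mul_sum]
    refine Finset.sum_congr rfl fun j _ => ?_
    rw [lerayDerivSymbol_eq_mul_entry]; ring
  rw [h1, enorm_mul]
  have h2π : ‖-(2 * π * Complex.I)‖ₑ = ENNReal.ofReal (2 * π) := by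
    rw [enorm_neg, ← ofReal_norm]
    simp [Complex.norm_real, abs_of_pos Real.pi_pos]
  rw [h2π]
  calc ENNReal.ofReal (2 * π) * ‖∑ k, (((if k = l then (1 : ℝ) else 0) - ξ k * ξ l / ‖ξ‖ ^ 2 : ℝ) : ℂ) *
        ∑ j, ((ξ j : ℝ) : ℂ) * fconv (v · j) (W · k) ξ‖ₑ
      ≤ ENNReal.ofReal (2 * π) * ∑ k, 2 * ∑ j, ((fun η => ENNReal.ofReal ‖η‖ * ‖W η k‖ₑ) ⋆ₗ
          (fun ζ => ‖v ζ j‖ₑ)) ξ := by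
        gcongr
        refine (enorm_sum_le _ _).trans (Finset.sum_le_sum fun k _ => ?_)
        rw [enorm_mul]
        gcongr
        · rw [← ofReal_norm, Complex.norm_real, Real.norm_eq_abs]
          exact (ENNReal.ofReal_le_ofReal (abs_leray_entry_le_two k l ξ)).trans_eq (by simp)
        · rw [sum_coord_mul_fconv_eq_integral hdiv hv2 (hW2 k) (hWw k) ξ]
          refine (enorm_integral_le_lintegral_enorm _).trans ?_
          calc ∫⁻ η, ‖∑ j, ((η j : ℝ) : ℂ) * v (ξ - η) j * W η k‖ₑ
              ≤ ∫⁻ η, ∑ j, ENNReal.ofReal ‖η‖ * ‖W η k‖ₑ * ‖v (ξ - η) j‖ₑ := by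
                refine lintegral_mono fun η => (enorm_sum_le _ _).trans (Finset.sum_le_sum fun j _ => ?_)
                rw [enorm_mul, enorm_mul]
                calc ‖((η j : ℝ) : ℂ)‖ₑ * ‖v (ξ - η) j‖ₑ * ‖W η k‖ₑ
                    ≤ ENNReal.ofReal ‖η‖ * ‖v (ξ - η) j‖ₑ * ‖W η k‖ₑ := by
                      gcongr; exact enorm_coord_le η j
                  _ = _ := by ring
            _ = ∑ j, ((fun η => ENNReal.ofReal ‖η‖ * ‖W η k‖ₑ) ⋆ₗ (fun ζ => ‖v ζ j‖ₑ)) ξ := by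
                rw [lintegral_finsetSum' _ fun j _ => ?_]
                · exact Finset.sum_congr rfl fun j _ => by rw [lconv_apply]
                · exact ((ENNReal.continuous_ofReal.measurable.comp continuous_norm.measurable).aemeasurable.mul
                    (hW2 k).1.enorm).mul (aemeasurable_comp_sub_left (hv2 j).1.enorm ξ)
    _ = ENNReal.ofReal (4 * π) *
          ∑ j, ∑ k, ((fun η => ENNReal.ofReal ‖η‖ * ‖W η k‖ₑ) ⋆ₗ (fun ζ => ‖v ζ j‖ₑ)) ξ := by
        have h4π : ENNReal.ofReal (4 * π) = ENNReal.ofReal (2 * π) * 2 := by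
          rw [show (4 * π : ℝ) = 2 * π * 2 by ring, ENNReal.ofReal_mul' (by norm_num : (0 : ℝ) ≤ 2),
            ENNReal.ofReal_ofNat]
        rw [Finset.sum_comm, ← Finset.mul_sum, ← mul_assoc, h4π]

end NonlinBound

/-! ### Weighted square-integrability bookkeeping -/

section WeightedMemLp

variable {f : EuclideanSpace ℝ ι → ℂ} {m : ℕ}

omit [Fintype ι] in
/-- `‖(r : ℂ) z‖ₑ = ofReal r · ‖z‖ₑ` for `r ≥ 0`. [folklore] -/
theorem enorm_ofReal_mul {r : ℝ} (hr : 0 ≤ r) (z : ℂ) :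
    ‖((r : ℝ) : ℂ) * z‖ₑ = ENNReal.ofReal r * ‖z‖ₑ := by
  rw [enorm_mul, ← ofReal_norm ((r : ℝ) : ℂ), Complex.norm_real, Real.norm_of_nonneg hr]

/-- Transfer of weighted square integrability to a smaller continuous weight. [folklore] -/
theorem memLp_ofReal_mul_of_abs_le {w w' : EuclideanSpace ℝ ι → ℝ}
    (h : MemLp (fun ζ => ((w ζ : ℝ) : ℂ) * f ζ) 2 volume) (hw' : Continuous w')
    (hf : AEStronglyMeasurable f volume) (hle : ∀ ζ, |w' ζ| ≤ |w ζ|) :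
    MemLp (fun ζ => ((w' ζ : ℝ) : ℂ) * f ζ) 2 volume := by
  refine MemLp.of_le_mul (c := 1) h
    ((Complex.continuous_ofReal.comp hw').aestronglyMeasurable.mul hf)
    (Eventually.of_forall fun ζ => ?_)
  rw [one_mul, norm_mul, norm_mul, Complex.norm_real, Complex.norm_real, Real.norm_eq_abs,
    Real.norm_eq_abs]
  exact mul_le_mul_of_nonneg_right (hle ζ) (norm_nonneg _)

/-- From `(1 + ‖·‖)^(m+1) f ∈ L²`: `f ∈ L²`. [folklore] -/
theorem memLp_of_weight_succ (hf : AEStronglyMeasurable f volume)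
    (h : MemLp (fun ζ => (((1 + ‖ζ‖) ^ (m + 1) : ℝ) : ℂ) * f ζ) 2 volume) : MemLp f 2 volume := by
  have h1 := memLp_ofReal_mul_of_abs_le (w' := fun _ => (1 : ℝ)) h continuous_const hf fun ζ => by
    rw [abs_one, abs_of_nonneg (by positivity)]; exact one_le_one_add_norm_pow ζ (m + 1)
  simpa using h1

/-- From `(1 + ‖·‖)^(m+1) f ∈ L²`: `‖·‖ f ∈ L²`. [folklore] -/
theorem memLp_norm_mul_of_weight_succ (hf : AEStronglyMeasurable f volume)
    (h : MemLp (fun ζ => (((1 + ‖ζ‖) ^ (m + 1) : ℝ) : ℂ) * f ζ) 2 volume) :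
    MemLp (fun ζ => ((‖ζ‖ : ℝ) : ℂ) * f ζ) 2 volume := by
  refine memLp_ofReal_mul_of_abs_le h continuous_norm hf fun ζ => ?_
  rw [abs_norm, abs_of_nonneg (by positivity)]
  calc ‖ζ‖ ≤ 1 + ‖ζ‖ := by linarith [norm_nonneg ζ]
    _ ≤ (1 + ‖ζ‖) ^ (m + 1) := le_self_pow₀ (one_le_one_add_norm ζ) (Nat.succ_ne_zero m)

/-- From `(1 + ‖·‖)^(m+1) f ∈ L²`: `(1 + ‖·‖)^m f ∈ L²`. [folklore] -/
theorem memLp_weight_mul_of_weight_succ (hf : AEStronglyMeasurable f volume)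
    (h : MemLp (fun ζ => (((1 + ‖ζ‖) ^ (m + 1) : ℝ) : ℂ) * f ζ) 2 volume) :
    MemLp (fun ζ => (((1 + ‖ζ‖) ^ m : ℝ) : ℂ) * f ζ) 2 volume := by
  refine memLp_ofReal_mul_of_abs_le h (by fun_prop) hf fun ζ => ?_
  rw [abs_of_nonneg (by positivity), abs_of_nonneg (by positivity)]
  exact pow_le_pow_right₀ (one_le_one_add_norm ζ) (Nat.le_succ m)

/-- From `(1 + ‖·‖)^(m+1) f ∈ L²`: `‖·‖ (1 + ‖·‖)^m f ∈ L²`. [folklore] -/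
theorem memLp_norm_mul_weight_mul_of_weight_succ (hf : AEStronglyMeasurable f volume)
    (h : MemLp (fun ζ => (((1 + ‖ζ‖) ^ (m + 1) : ℝ) : ℂ) * f ζ) 2 volume) :
    MemLp (fun ζ => ((‖ζ‖ : ℝ) : ℂ) * ((((1 + ‖ζ‖) ^ m : ℝ) : ℂ) * f ζ)) 2 volume := by
  have h1 := memLp_ofReal_mul_of_abs_le (w' := fun ζ => ‖ζ‖ * (1 + ‖ζ‖) ^ m) h (by fun_prop) hf
    fun ζ => by
      rw [abs_of_nonneg (by positivity), abs_of_nonneg (by positivity), pow_succ']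
      exact mul_le_mul_of_nonneg_right (by linarith [norm_nonneg ζ]) (by positivity)
  refine MemLp.ae_eq (Eventually.of_forall fun ζ => ?_) h1
  simp only
  push_cast; ring

/-- From `(1 + ‖·‖)^m f ∈ L²`: `∫⁻ ((1 + ‖·‖)^m ‖f‖ₑ)² < ∞`. [folklore] -/
theorem lintegral_weight_mul_enorm_sq_lt_top
    (h : MemLp (fun ζ => (((1 + ‖ζ‖) ^ m : ℝ) : ℂ) * f ζ) 2 volume) :
    ∫⁻ ζ, (ENNReal.ofReal ((1 + ‖ζ‖) ^ m) * ‖f ζ‖ₑ) ^ 2 < ⊤ := by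
  have h1 : ∫⁻ ζ, ‖(((1 + ‖ζ‖) ^ m : ℝ) : ℂ) * f ζ‖ₑ ^ 2 < ⊤ := by
    rw [lintegral_enorm_sq_eq_eLpNorm_sq]; exact ENNReal.pow_lt_top h.eLpNorm_lt_top
  refine lt_of_le_of_lt (le_of_eq (lintegral_congr fun ζ => ?_)) h1
  rw [enorm_ofReal_mul (by positivity)]

end WeightedMemLp

/-! ### The `H^m` commutator estimate -/

section Commutator

variable {v G : EuclideanSpace ℝ ι → ι → ℂ} {m : ℕ}

/-- Measurability of the commutator kernel
`Q(ξ, η) = ∑_{j,k} η_j v_j(ξ − η) (ρ(ξ) − ρ(η)) G_k(η) ρ(ξ) conj G_k(ξ)`, `ρ = (1 + ‖·‖)^m`. [folklore] -/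
theorem aestronglyMeasurable_commutatorKernel (hv : AEStronglyMeasurable v volume)
    (hG : AEStronglyMeasurable G volume) (m : ℕ) :
    AEStronglyMeasurable (fun p : EuclideanSpace ℝ ι × EuclideanSpace ℝ ι =>
      ∑ j, ∑ k, ((p.2 j : ℝ) : ℂ) * v (p.1 - p.2) j *
        ((((1 + ‖p.1‖) ^ m - (1 + ‖p.2‖) ^ m : ℝ) : ℂ) * G p.2 k *
          conj ((((1 + ‖p.1‖) ^ m : ℝ) : ℂ) * G p.1 k))) (volume.prod volume) := by
  refine Finset.aestronglyMeasurable_fun_sum _ fun j _ =>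
    Finset.aestronglyMeasurable_fun_sum _ fun k _ => ?_
  have h1 : AEStronglyMeasurable (fun p : EuclideanSpace ℝ ι × EuclideanSpace ℝ ι =>
      ((p.2 j : ℝ) : ℂ)) (volume.prod volume) :=
    (Complex.continuous_ofReal.comp ((EuclideanSpace.proj j).continuous.comp
      continuous_snd)).aestronglyMeasurable
  have h2 : AEStronglyMeasurable (fun p : EuclideanSpace ℝ ι × EuclideanSpace ℝ ι =>
      v (p.1 - p.2) j) (volume.prod volume) :=
    (aesm_apply hv j).comp_quasiMeasurePreserving (quasiMeasurePreserving_sub volume volume)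
  have h3 : AEStronglyMeasurable (fun p : EuclideanSpace ℝ ι × EuclideanSpace ℝ ι =>
      (((1 + ‖p.1‖) ^ m - (1 + ‖p.2‖) ^ m : ℝ) : ℂ)) (volume.prod volume) :=
    (Complex.continuous_ofReal.comp (by fun_prop)).aestronglyMeasurable
  have h4 : AEStronglyMeasurable (fun p : EuclideanSpace ℝ ι × EuclideanSpace ℝ ι => G p.2 k)
      (volume.prod volume) := (aesm_apply hG k).comp_snd
  have h5 : AEStronglyMeasurable (fun p : EuclideanSpace ℝ ι × EuclideanSpace ℝ ι =>
      conj ((((1 + ‖p.1‖) ^ m : ℝ) : ℂ) * G p.1 k)) (volume.prod volume) := by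
    have hc : Continuous fun ξ : EuclideanSpace ℝ ι => (((1 + ‖ξ‖) ^ m : ℝ) : ℂ) :=
      Complex.continuous_ofReal.comp (by fun_prop)
    have h6 : AEStronglyMeasurable (fun ξ : EuclideanSpace ℝ ι =>
        conj ((((1 + ‖ξ‖) ^ m : ℝ) : ℂ) * G ξ k)) volume :=
      Complex.continuous_conj.comp_aestronglyMeasurable (hc.aestronglyMeasurable.mul (aesm_apply hG k))
    exact h6.comp_fst
  exact (h1.mul h2).mul ((h3.mul h4).mul h5)

/-- **The commutator kernel bound** (Young's inequality on the two pieces of the weight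
commutator inequality): with `ρ = (1 + ‖·‖)^m`, `V = ∑_j ‖v_j‖ₑ`,
`∫⁻∫⁻ ‖Q(ξ, η)‖ₑ ≤ m 2^(m-1) ∑_k ‖ρ G_k‖₂ (‖‖·‖ ρ_(m-1) G_k‖₂ ‖‖·‖V‖₁ + ‖ρ V‖₂ ‖‖·‖ G_k‖₁)`.
[cite: MajdaBertozzi2002, Lemma 3.4 (3.32)] -/
theorem lintegral_lintegral_commutatorKernel_le (hv : AEStronglyMeasurable v volume)
    (hG : AEStronglyMeasurable G volume) (m : ℕ) :
    ∫⁻ ξ, ∫⁻ η, ‖∑ j, ∑ k, ((η j : ℝ) : ℂ) * v (ξ - η) j *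
        ((((1 + ‖ξ‖) ^ m - (1 + ‖η‖) ^ m : ℝ) : ℂ) * G η k *
          conj ((((1 + ‖ξ‖) ^ m : ℝ) : ℂ) * G ξ k))‖ₑ ≤
      (m * 2 ^ (m - 1) : ℝ≥0∞) * ∑ k,
        ((∫⁻ ξ, (ENNReal.ofReal ((1 + ‖ξ‖) ^ m) * ‖G ξ k‖ₑ) ^ 2) ^ (1 / 2 : ℝ) *
            (∫⁻ η, (ENNReal.ofReal ‖η‖ * ENNReal.ofReal ((1 + ‖η‖) ^ (m - 1)) * ‖G η k‖ₑ) ^ 2) ^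
              (1 / 2 : ℝ) *
            (∫⁻ ζ, ENNReal.ofReal ‖ζ‖ * ∑ j, ‖v ζ j‖ₑ) +
          (∫⁻ ξ, (ENNReal.ofReal ((1 + ‖ξ‖) ^ m) * ‖G ξ k‖ₑ) ^ 2) ^ (1 / 2 : ℝ) *
            (∫⁻ ζ, (ENNReal.ofReal ((1 + ‖ζ‖) ^ m) * ∑ j, ‖v ζ j‖ₑ) ^ 2) ^ (1 / 2 : ℝ) *
            ∫⁻ η, ENNReal.ofReal ‖η‖ * ‖G η k‖ₑ) := by
  -- the majorants
  set K : ℝ≥0∞ := (m * 2 ^ (m - 1) : ℝ≥0∞) with hK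
  set V : EuclideanSpace ℝ ι → ℝ≥0∞ := fun ζ => ∑ j, ‖v ζ j‖ₑ with hV
  set Θ : ι → EuclideanSpace ℝ ι → ℝ≥0∞ := fun k ξ => ENNReal.ofReal ((1 + ‖ξ‖) ^ m) * ‖G ξ k‖ₑ
    with hΘ
  set Φ₁ : ι → EuclideanSpace ℝ ι → ℝ≥0∞ := fun k η =>
    ENNReal.ofReal ‖η‖ * ENNReal.ofReal ((1 + ‖η‖) ^ (m - 1)) * ‖G η k‖ₑ with hΦ₁
  set Ψ₁ : EuclideanSpace ℝ ι → ℝ≥0∞ := fun ζ => ENNReal.ofReal ‖ζ‖ * V ζ with hΨ₁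
  set Φ₂ : ι → EuclideanSpace ℝ ι → ℝ≥0∞ := fun k η => ENNReal.ofReal ‖η‖ * ‖G η k‖ₑ with hΦ₂
  set Ψ₂ : EuclideanSpace ℝ ι → ℝ≥0∞ := fun ζ => ENNReal.ofReal ((1 + ‖ζ‖) ^ m) * V ζ with hΨ₂
  have hKtop : K ≠ ⊤ :=
    ENNReal.mul_ne_top (ENNReal.natCast_ne_top m) (ENNReal.pow_ne_top (by simp))
  have hVm : AEMeasurable V volume :=
    Finset.aemeasurable_fun_sum _ fun j _ => (aesm_apply hv j).enorm
  have hGm : ∀ k, AEMeasurable (fun η => ‖G η k‖ₑ) volume := fun k => (aesm_apply hG k).enorm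
  have hn : Measurable fun η : EuclideanSpace ℝ ι => ENNReal.ofReal ‖η‖ :=
    ENNReal.continuous_ofReal.measurable.comp continuous_norm.measurable
  have hw : ∀ n : ℕ, Measurable fun η : EuclideanSpace ℝ ι => ENNReal.ofReal ((1 + ‖η‖) ^ n) :=
    fun n => measurable_ofReal_weight n
  have hΘm : ∀ k, AEMeasurable (Θ k) volume := fun k => (hw m).aemeasurable.mul (hGm k)
  have hΦ₁m : ∀ k, AEMeasurable (Φ₁ k) volume := fun k =>
    (hn.aemeasurable.mul (hw (m - 1)).aemeasurable).mul (hGm k)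
  have hΨ₁m : AEMeasurable Ψ₁ volume := hn.aemeasurable.mul hVm
  have hΦ₂m : ∀ k, AEMeasurable (Φ₂ k) volume := fun k => hn.aemeasurable.mul (hGm k)
  have hΨ₂m : AEMeasurable Ψ₂ volume := (hw m).aemeasurable.mul hVm
  -- bookkeeping of the double sums
  have halg : ∀ (a b θ φ₁ φ₂ : ι → ℝ≥0∞),
      ∑ j, ∑ k, K * (θ k * (φ₁ k * a j + φ₂ k * b j)) =
        K * ∑ k, θ k * (φ₁ k * ∑ j, a j + φ₂ k * ∑ j, b j) := by
    intro a b θ φ₁ φ₂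
    rw [Finset.sum_comm, Finset.mul_sum]
    refine Finset.sum_congr rfl fun k _ => ?_
    rw [Finset.mul_sum, Finset.mul_sum, ← Finset.sum_add_distrib, Finset.mul_sum, Finset.mul_sum]
  -- pointwise bound of the kernel
  have hpt : ∀ ξ η, ‖∑ j, ∑ k, ((η j : ℝ) : ℂ) * v (ξ - η) j *
        ((((1 + ‖ξ‖) ^ m - (1 + ‖η‖) ^ m : ℝ) : ℂ) * G η k *
          conj ((((1 + ‖ξ‖) ^ m : ℝ) : ℂ) * G ξ k))‖ₑ ≤
      K * ∑ k, Θ k ξ * (Φ₁ k η * Ψ₁ (ξ - η) + Φ₂ k η * Ψ₂ (ξ - η)) := by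
    intro ξ η
    have hwt := enorm_weight_sub_weight_le m ξ η
    calc ‖∑ j, ∑ k, ((η j : ℝ) : ℂ) * v (ξ - η) j *
          ((((1 + ‖ξ‖) ^ m - (1 + ‖η‖) ^ m : ℝ) : ℂ) * G η k *
            conj ((((1 + ‖ξ‖) ^ m : ℝ) : ℂ) * G ξ k))‖ₑ
        ≤ ∑ j, ∑ k, ‖((η j : ℝ) : ℂ) * v (ξ - η) j *
          ((((1 + ‖ξ‖) ^ m - (1 + ‖η‖) ^ m : ℝ) : ℂ) * G η k *
            conj ((((1 + ‖ξ‖) ^ m : ℝ) : ℂ) * G ξ k))‖ₑ := by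
          refine (enorm_sum_le _ _).trans (Finset.sum_le_sum fun j _ => enorm_sum_le _ _)
      _ ≤ ∑ j, ∑ k, K * (Θ k ξ * (Φ₁ k η * (ENNReal.ofReal ‖ξ - η‖ * ‖v (ξ - η) j‖ₑ) +
          Φ₂ k η * (ENNReal.ofReal ((1 + ‖ξ - η‖) ^ m) * ‖v (ξ - η) j‖ₑ))) := by
          refine Finset.sum_le_sum fun j _ => Finset.sum_le_sum fun k _ => ?_
          rw [enorm_mul, enorm_mul, enorm_mul, enorm_mul, RCLike.enorm_conj,
            enorm_ofReal_mul (by positivity)]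
          calc ‖((η j : ℝ) : ℂ)‖ₑ * ‖v (ξ - η) j‖ₑ *
                (‖(((1 + ‖ξ‖) ^ m - (1 + ‖η‖) ^ m : ℝ) : ℂ)‖ₑ * ‖G η k‖ₑ *
                  (ENNReal.ofReal ((1 + ‖ξ‖) ^ m) * ‖G ξ k‖ₑ))
              ≤ ENNReal.ofReal ‖η‖ * ‖v (ξ - η) j‖ₑ *
                ((K * (ENNReal.ofReal ‖ξ - η‖ * ENNReal.ofReal ((1 + ‖η‖) ^ (m - 1)) +
                  ENNReal.ofReal ((1 + ‖ξ - η‖) ^ m))) * ‖G η k‖ₑ *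
                  (ENNReal.ofReal ((1 + ‖ξ‖) ^ m) * ‖G ξ k‖ₑ)) := by
                gcongr
                · exact enorm_coord_le η j
                · rw [← ofReal_norm, Complex.norm_real, ofReal_norm]
                  exact hwt
            _ = _ := by simp only [hΘ, hΦ₁, hΦ₂]; ring
      _ = K * ∑ k, Θ k ξ * (Φ₁ k η * Ψ₁ (ξ - η) + Φ₂ k η * Ψ₂ (ξ - η)) := by
          rw [halg]
          simp only [hΨ₁, hΨ₂, hV, Finset.mul_sum]
  -- integrate in `η`
  have hinner : ∀ ξ, ∫⁻ η, K * ∑ k, Θ k ξ * (Φ₁ k η * Ψ₁ (ξ - η) + Φ₂ k η * Ψ₂ (ξ - η)) =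
      K * ∑ k, Θ k ξ * ((Φ₁ k ⋆ₗ Ψ₁) ξ + (Φ₂ k ⋆ₗ Ψ₂) ξ) := by
    intro ξ
    rw [lintegral_const_mul' _ _ hKtop]
    congr 1
    have hmk : ∀ k, AEMeasurable (fun η => Θ k ξ * (Φ₁ k η * Ψ₁ (ξ - η) + Φ₂ k η * Ψ₂ (ξ - η)))
        volume := fun k =>
      (((hΦ₁m k).mul (aemeasurable_comp_sub_left hΨ₁m ξ)).add
        ((hΦ₂m k).mul (aemeasurable_comp_sub_left hΨ₂m ξ))).const_mul _
    rw [lintegral_finsetSum' (f := fun k η => Θ k ξ * (Φ₁ k η * Ψ₁ (ξ - η) + Φ₂ k η * Ψ₂ (ξ - η)))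
      _ fun k _ => hmk k]
    refine Finset.sum_congr rfl fun k _ => ?_
    have hΘtop : Θ k ξ ≠ ⊤ := ENNReal.mul_ne_top ENNReal.ofReal_ne_top enorm_ne_top
    rw [lintegral_const_mul' _ _ hΘtop, lconv_apply, lconv_apply]
    congr 1
    exact lintegral_add_left' ((hΦ₁m k).mul (aemeasurable_comp_sub_left hΨ₁m ξ)) _
  calc ∫⁻ ξ, ∫⁻ η, ‖∑ j, ∑ k, ((η j : ℝ) : ℂ) * v (ξ - η) j *
          ((((1 + ‖ξ‖) ^ m - (1 + ‖η‖) ^ m : ℝ) : ℂ) * G η k *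
            conj ((((1 + ‖ξ‖) ^ m : ℝ) : ℂ) * G ξ k))‖ₑ
      ≤ ∫⁻ ξ, ∫⁻ η, K * ∑ k, Θ k ξ * (Φ₁ k η * Ψ₁ (ξ - η) + Φ₂ k η * Ψ₂ (ξ - η)) :=
        lintegral_mono fun ξ => lintegral_mono fun η => hpt ξ η
    _ = ∫⁻ ξ, K * ∑ k, Θ k ξ * ((Φ₁ k ⋆ₗ Ψ₁) ξ + (Φ₂ k ⋆ₗ Ψ₂) ξ) := lintegral_congr hinner
    _ = K * ∑ k, ((∫⁻ ξ, Θ k ξ * (Φ₁ k ⋆ₗ Ψ₁) ξ) + ∫⁻ ξ, Θ k ξ * (Φ₂ k ⋆ₗ Ψ₂) ξ) := by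
        rw [lintegral_const_mul' _ _ hKtop]
        congr 1
        have hmeas : ∀ k, AEMeasurable (fun ξ => Θ k ξ * (Φ₁ k ⋆ₗ Ψ₁) ξ) volume := fun k =>
          (hΘm k).mul (aemeasurable_lconvolution (hΦ₁m k) hΨ₁m)
        have hmeas' : ∀ k, AEMeasurable (fun ξ => Θ k ξ * (Φ₂ k ⋆ₗ Ψ₂) ξ) volume := fun k =>
          (hΘm k).mul (aemeasurable_lconvolution (hΦ₂m k) hΨ₂m)
        have hsplit : ∀ k ξ, Θ k ξ * ((Φ₁ k ⋆ₗ Ψ₁) ξ + (Φ₂ k ⋆ₗ Ψ₂) ξ) =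
            Θ k ξ * (Φ₁ k ⋆ₗ Ψ₁) ξ + Θ k ξ * (Φ₂ k ⋆ₗ Ψ₂) ξ := fun k ξ => mul_add _ _ _
        simp_rw [hsplit]
        rw [lintegral_finsetSum' (f := fun k ξ => Θ k ξ * (Φ₁ k ⋆ₗ Ψ₁) ξ + Θ k ξ * (Φ₂ k ⋆ₗ Ψ₂) ξ)
          _ fun k _ => (hmeas k).add (hmeas' k)]
        refine Finset.sum_congr rfl fun k _ => ?_
        exact lintegral_add_left' (hmeas k) (fun ξ => Θ k ξ * (Φ₂ k ⋆ₗ Ψ₂) ξ)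
    _ ≤ K * ∑ k, ((∫⁻ ξ, Θ k ξ ^ 2) ^ (1 / 2 : ℝ) * (∫⁻ η, Φ₁ k η ^ 2) ^ (1 / 2 : ℝ) * (∫⁻ η, Ψ₁ η) +
          (∫⁻ ξ, Θ k ξ ^ 2) ^ (1 / 2 : ℝ) * (∫⁻ η, Ψ₂ η ^ 2) ^ (1 / 2 : ℝ) * ∫⁻ η, Φ₂ k η) := by
        gcongr with k
        · exact lintegral_mul_lconv_le (hΦ₁m k) hΨ₁m (hΘm k)
        · exact lintegral_mul_lconv_le' (hΦ₂m k) hΨ₂m (hΘm k)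


/-- **The `H^m` commutator estimate on the Fourier side** (the Fourier-side form of
Majda–Bertozzi 2002, Prop. 3.7, (3.58): `½ d/dt ‖v‖²_m ≤ c_m |∇Jv|_∞ ‖v‖²_m` for `ν = 0`, obtained
there from the cancellation of the top-order term and the calculus inequality (3.32)). For a
transporting field `v` (divergence free and conjugation symmetric a.e.) and a transported field
`G` (divergence free a.e.), with `ρ = (1 + ‖·‖)^m` and `V = ∑_j |v_j|`,
`|Re ∫ ∑_l ρ(ξ)² N(v, G)(ξ)_l conj G_l(ξ) dξ|
   ≤ 2π · m 2^(m-1) ∑_k ‖ρG_k‖₂ (‖‖·‖ρ_(m-1)G_k‖₂ ‖‖·‖V‖₁ + ‖ρV‖₂ ‖‖·‖G_k‖₁)`: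
write `ρ(ξ)² = ρ(ξ)ρ(η) + ρ(ξ)(ρ(ξ) − ρ(η))`; the first part is the transport form of `(v, ρG)`,
which is real (`im_integral_transportForm_eq_zero`), and the second is bounded by the weight
commutator inequality and Young's inequality (`lintegral_lintegral_commutatorKernel_le`). The
`L¹_ξ` norm `‖‖·‖V‖₁` plays the role of `|∇v|_{L^∞}`. Stated in `ℝ≥0∞`; the finiteness hypotheses are
those making the splitting legitimate. [cite: MajdaBertozzi2002, Prop. 3.7 (3.58) with Lemma 3.4 (3.32)] -/
theorem ofReal_abs_re_integral_weight_sq_nonlin_le [DecidableEq ι] (hv : AEStronglyMeasurable v volume)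
    (hG : AEStronglyMeasurable G volume)
    (hvdiv : ∀ᵐ ζ ∂(volume : Measure (EuclideanSpace ℝ ι)), ∑ j, ((ζ j : ℝ) : ℂ) * v ζ j = 0)
    (hvsym : ∀ᵐ ζ ∂(volume : Measure (EuclideanSpace ℝ ι)), ∀ j, v (-ζ) j = conj (v ζ j))
    (hGdiv : ∀ᵐ ξ ∂(volume : Measure (EuclideanSpace ℝ ι)), ∑ l, ((ξ l : ℝ) : ℂ) * G ξ l = 0)
    (hv1 : ∀ j, Integrable (fun ζ => v ζ j) volume) (hv2 : ∀ j, MemLp (fun ζ => v ζ j) 2 volume)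
    (hG2 : ∀ k, MemLp (fun η => (((1 + ‖η‖) ^ (m + 1) : ℝ) : ℂ) * G η k) 2 volume)
    (hVn1 : ∫⁻ ζ, ENNReal.ofReal ‖ζ‖ * ∑ j, ‖v ζ j‖ₑ < ⊤)
    (hVw2 : ∫⁻ ζ, (ENNReal.ofReal ((1 + ‖ζ‖) ^ m) * ∑ j, ‖v ζ j‖ₑ) ^ 2 < ⊤)
    (hGn1 : ∀ k, ∫⁻ η, ENNReal.ofReal ‖η‖ * ‖G η k‖ₑ < ⊤) :
    ENNReal.ofReal |(∫ ξ, ∑ l, (((1 + ‖ξ‖) ^ m : ℝ) : ℂ) ^ 2 * (nonlin v G ξ l * conj (G ξ l))).re| ≤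
      ENNReal.ofReal (2 * π) * ((m * 2 ^ (m - 1) : ℝ≥0∞) * ∑ k,
        ((∫⁻ ξ, (ENNReal.ofReal ((1 + ‖ξ‖) ^ m) * ‖G ξ k‖ₑ) ^ 2) ^ (1 / 2 : ℝ) *
            (∫⁻ η, (ENNReal.ofReal ‖η‖ * ENNReal.ofReal ((1 + ‖η‖) ^ (m - 1)) * ‖G η k‖ₑ) ^ 2) ^
              (1 / 2 : ℝ) *
            (∫⁻ ζ, ENNReal.ofReal ‖ζ‖ * ∑ j, ‖v ζ j‖ₑ) +
          (∫⁻ ξ, (ENNReal.ofReal ((1 + ‖ξ‖) ^ m) * ‖G ξ k‖ₑ) ^ 2) ^ (1 / 2 : ℝ) *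
            (∫⁻ ζ, (ENNReal.ofReal ((1 + ‖ζ‖) ^ m) * ∑ j, ‖v ζ j‖ₑ) ^ 2) ^ (1 / 2 : ℝ) *
            ∫⁻ η, ENNReal.ofReal ‖η‖ * ‖G η k‖ₑ)) := by
  -- the weighted fields
  set ρ : EuclideanSpace ℝ ι → ℝ := fun ξ => (1 + ‖ξ‖) ^ m with hρ
  have hρ0 : ∀ ξ, 0 ≤ ρ ξ := fun ξ => by positivity
  have hρc : Continuous ρ := by fun_prop
  set Gρ : EuclideanSpace ℝ ι → ι → ℂ := fun ξ => ((ρ ξ : ℝ) : ℂ) • G ξ with hGρ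
  have hGρ_apply : ∀ ξ k, Gρ ξ k = ((ρ ξ : ℝ) : ℂ) * G ξ k := fun ξ k => rfl
  set G₂ : EuclideanSpace ℝ ι → ι → ℂ := fun ξ => (((ρ ξ : ℝ) : ℂ) ^ 2) • G ξ with hG₂
  have hG₂_apply : ∀ ξ k, G₂ ξ k = ((ρ ξ : ℝ) : ℂ) ^ 2 * G ξ k := fun ξ k => rfl
  have hGρm : AEStronglyMeasurable Gρ volume :=
    (Complex.continuous_ofReal.comp hρc).aestronglyMeasurable.smul hG
  have hGk : ∀ k, AEStronglyMeasurable (fun η => G η k) volume := fun k => aesm_apply hG k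
  have hG2' : ∀ k, MemLp (fun η => G η k) 2 volume := fun k => memLp_of_weight_succ (hGk k) (hG2 k)
  have hGw' : ∀ k, MemLp (fun η => ((‖η‖ : ℝ) : ℂ) * G η k) 2 volume := fun k =>
    memLp_norm_mul_of_weight_succ (hGk k) (hG2 k)
  have hGρ2 : ∀ k, MemLp (fun η => Gρ η k) 2 volume := fun k =>
    memLp_weight_mul_of_weight_succ (hGk k) (hG2 k)
  have hGρw : ∀ k, MemLp (fun η => ((‖η‖ : ℝ) : ℂ) * Gρ η k) 2 volume := fun k =>
    memLp_norm_mul_weight_mul_of_weight_succ (hGk k) (hG2 k)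
  have hG₂div : ∀ᵐ ξ ∂(volume : Measure (EuclideanSpace ℝ ι)), ∑ l, ((ξ l : ℝ) : ℂ) * G₂ ξ l = 0 := by
    filter_upwards [hGdiv] with ξ hξ
    simp only [hG₂_apply]
    calc ∑ l, ((ξ l : ℝ) : ℂ) * (((ρ ξ : ℝ) : ℂ) ^ 2 * G ξ l)
        = ((ρ ξ : ℝ) : ℂ) ^ 2 * ∑ l, ((ξ l : ℝ) : ℂ) * G ξ l := by
          rw [Finset.mul_sum]; exact Finset.sum_congr rfl fun l _ => by ring
      _ = 0 := by rw [hξ, mul_zero]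
  -- the kernels
  set P : EuclideanSpace ℝ ι × EuclideanSpace ℝ ι → ℂ := fun p =>
    ∑ j, ∑ k, ((p.2 j : ℝ) : ℂ) * v (p.1 - p.2) j * (Gρ p.2 k * conj (Gρ p.1 k)) with hP
  set Q : EuclideanSpace ℝ ι × EuclideanSpace ℝ ι → ℂ := fun p =>
    ∑ j, ∑ k, ((p.2 j : ℝ) : ℂ) * v (p.1 - p.2) j *
      ((((1 + ‖p.1‖) ^ m - (1 + ‖p.2‖) ^ m : ℝ) : ℂ) * G p.2 k *
        conj ((((1 + ‖p.1‖) ^ m : ℝ) : ℂ) * G p.1 k)) with hQ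
  set T : EuclideanSpace ℝ ι × EuclideanSpace ℝ ι → ℂ := fun p =>
    ∑ j, ∑ k, ((p.2 j : ℝ) : ℂ) * v (p.1 - p.2) j * (G p.2 k * conj (G₂ p.1 k)) with hT
  have hTPQ : ∀ p, T p = P p + Q p := by
    intro p
    simp only [hT, hP, hQ, hGρ_apply, hG₂_apply, hρ]
    rw [← Finset.sum_add_distrib]
    refine Finset.sum_congr rfl fun j _ => ?_
    rw [← Finset.sum_add_distrib]
    refine Finset.sum_congr rfl fun k _ => ?_
    simp only [map_mul, map_pow, Complex.conj_ofReal]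
    push_cast
    ring
  have hPint : Integrable P (volume.prod volume) := integrable_transportForm hv1 hGρm hGρ2 hGρw
  -- the bound of the commutator kernel and its finiteness
  have hQbd := lintegral_lintegral_commutatorKernel_le (v := v) (G := G) hv hG m
  set B : ℝ≥0∞ := (m * 2 ^ (m - 1) : ℝ≥0∞) * ∑ k,
        ((∫⁻ ξ, (ENNReal.ofReal ((1 + ‖ξ‖) ^ m) * ‖G ξ k‖ₑ) ^ 2) ^ (1 / 2 : ℝ) *
            (∫⁻ η, (ENNReal.ofReal ‖η‖ * ENNReal.ofReal ((1 + ‖η‖) ^ (m - 1)) * ‖G η k‖ₑ) ^ 2) ^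
              (1 / 2 : ℝ) *
            (∫⁻ ζ, ENNReal.ofReal ‖ζ‖ * ∑ j, ‖v ζ j‖ₑ) +
          (∫⁻ ξ, (ENNReal.ofReal ((1 + ‖ξ‖) ^ m) * ‖G ξ k‖ₑ) ^ 2) ^ (1 / 2 : ℝ) *
            (∫⁻ ζ, (ENNReal.ofReal ((1 + ‖ζ‖) ^ m) * ∑ j, ‖v ζ j‖ₑ) ^ 2) ^ (1 / 2 : ℝ) *
            ∫⁻ η, ENNReal.ofReal ‖η‖ * ‖G η k‖ₑ) with hB
  have hBtop : B < ⊤ := by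
    have hGR : ∀ k, (∫⁻ ξ, (ENNReal.ofReal ((1 + ‖ξ‖) ^ m) * ‖G ξ k‖ₑ) ^ 2) ^ (1 / 2 : ℝ) < ⊤ :=
      fun k => ENNReal.rpow_lt_top_of_nonneg (by norm_num)
        (lintegral_weight_mul_enorm_sq_lt_top (hGρ2 k)).ne
    have hΦ₁ : ∀ k, (∫⁻ η, (ENNReal.ofReal ‖η‖ * ENNReal.ofReal ((1 + ‖η‖) ^ (m - 1)) *
        ‖G η k‖ₑ) ^ 2) ^ (1 / 2 : ℝ) < ⊤ := by
      intro k
      refine ENNReal.rpow_lt_top_of_nonneg (by norm_num) (lt_of_le_of_lt ?_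
        (lintegral_weight_mul_enorm_sq_lt_top (hG2 k))).ne
      refine lintegral_mono fun η => ?_
      gcongr
      rw [← ENNReal.ofReal_mul (norm_nonneg _)]
      refine ENNReal.ofReal_le_ofReal ?_
      calc ‖η‖ * (1 + ‖η‖) ^ (m - 1) ≤ (1 + ‖η‖) * (1 + ‖η‖) ^ m := by
            gcongr
            · linarith [norm_nonneg η]
            · exact one_le_one_add_norm η
            · exact Nat.sub_le m 1
        _ = (1 + ‖η‖) ^ (m + 1) := by ring
    have hVw : (∫⁻ ζ, (ENNReal.ofReal ((1 + ‖ζ‖) ^ m) * ∑ j, ‖v ζ j‖ₑ) ^ 2) ^ (1 / 2 : ℝ) < ⊤ :=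
      ENNReal.rpow_lt_top_of_nonneg (by norm_num) hVw2.ne
    rw [hB]
    refine ENNReal.mul_lt_top (ENNReal.mul_lt_top (ENNReal.natCast_lt_top m)
      (ENNReal.pow_lt_top (by simp))) (ENNReal.sum_lt_top.2 fun k _ => ?_)
    exact ENNReal.add_lt_top.2 ⟨ENNReal.mul_lt_top (ENNReal.mul_lt_top (hGR k) (hΦ₁ k)) hVn1,
      ENNReal.mul_lt_top (ENNReal.mul_lt_top (hGR k) hVw) (hGn1 k)⟩
  have hQint : Integrable Q (volume.prod volume) := by
    refine ⟨aestronglyMeasurable_commutatorKernel hv hG m, ?_⟩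
    rw [hasFiniteIntegral_iff_enorm, lintegral_prod _
      (aestronglyMeasurable_commutatorKernel hv hG m).enorm]
    exact lt_of_le_of_lt hQbd hBtop
  have hTint : Integrable T (volume.prod volume) := by
    have : T = P + Q := funext fun p => by rw [Pi.add_apply]; exact hTPQ p
    rw [this]; exact hPint.add hQint
  -- Step 1: the paired weighted nonlinearity as the double integral of `T`
  have hstep1 : ∫ ξ, ∑ l, (((1 + ‖ξ‖) ^ m : ℝ) : ℂ) ^ 2 * (nonlin v G ξ l * conj (G ξ l)) =
      -(2 * π * Complex.I) * ∫ ξ, ∫ η, T (ξ, η) := by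
    have h1 : ∀ ξ, ∑ l, (((1 + ‖ξ‖) ^ m : ℝ) : ℂ) ^ 2 * (nonlin v G ξ l * conj (G ξ l)) =
        ∑ l, nonlin v G ξ l * conj (G₂ ξ l) := fun ξ =>
      Finset.sum_congr rfl fun l _ => by
        rw [hG₂_apply, map_mul, map_pow, Complex.conj_ofReal]; ring
    simp_rw [h1]
    exact integral_sum_nonlin_mul_conj_eq hvdiv hv2 hG2' hGw' hG₂div
  -- Step 2: split `T = P + Q` under the double integral
  have hstep2 : ∫ ξ, ∫ η, T (ξ, η) = (∫ ξ, ∫ η, P (ξ, η)) + ∫ ξ, ∫ η, Q (ξ, η) := by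
    have h1 : (fun ξ => ∫ η, T (ξ, η)) =ᵐ[volume] fun ξ => (∫ η, P (ξ, η)) + ∫ η, Q (ξ, η) := by
      filter_upwards [hPint.prod_right_ae, hQint.prod_right_ae] with ξ hPξ hQξ
      simp_rw [hTPQ]
      exact integral_add hPξ hQξ
    rw [integral_congr_ae h1]
    exact integral_add hPint.integral_prod_left hQint.integral_prod_left
  -- Step 3: the transport part is real
  have hPim : (∫ ξ, ∫ η, P (ξ, η)).im = 0 :=
    im_integral_transportForm_eq_zero (G := Gρ) hv1 hGρm hGρ2 hGρw hvdiv hvsym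
  -- Step 4: assemble
  have hre : (∫ ξ, ∑ l, (((1 + ‖ξ‖) ^ m : ℝ) : ℂ) ^ 2 * (nonlin v G ξ l * conj (G ξ l))).re =
      2 * π * (∫ ξ, ∫ η, Q (ξ, η)).im := by
    rw [hstep1, hstep2]
    simp [Complex.mul_re, Complex.mul_im, hPim]
  rw [hre, abs_mul, abs_of_pos Real.two_pi_pos, ENNReal.ofReal_mul Real.two_pi_pos.le]
  gcongr
  calc ENNReal.ofReal |(∫ ξ, ∫ η, Q (ξ, η)).im| ≤ ‖∫ ξ, ∫ η, Q (ξ, η)‖ₑ := by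
        rw [← ofReal_norm]
        exact ENNReal.ofReal_le_ofReal (Complex.abs_im_le_norm _)
    _ ≤ ∫⁻ ξ, ‖∫ η, Q (ξ, η)‖ₑ := enorm_integral_le_lintegral_enorm _
    _ ≤ ∫⁻ ξ, ∫⁻ η, ‖Q (ξ, η)‖ₑ := lintegral_mono fun ξ => enorm_integral_le_lintegral_enorm _
    _ ≤ B := hQbd

end Commutator

end Literature.Analysis.FluidPDE.FourierNS

end
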